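import Summits.KontsevichZagierPeriods.KontsevichZagierPeriods.Theorems.RootDecompRelativeModAbsoluteCylLogSplitP50
import Summits.KontsevichZagierPeriods.KontsevichZagierPeriods.Theorems.RootDecompRelativeModAbsoluteCircleLogP7
import Summits.KontsevichZagierPeriods.KontsevichZagierPeriods.Theorems.RootDecompRelativeModAbsoluteCylLogSplitP23
import Literature.NumberTheory.Transcendental.SemialgebraicAlgebraicPoints
import Literature.NumberTheory.Transcendental.KZLogCalculusProofs
import Literature.NumberTheory.Transcendental.KZSemiCanonicalReductionProofs
import Literature.NumberTheory.Transcendental.KZDominatedFamilyRelations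
import Literature.NumberTheory.Transcendental.KZSemialgebraicComplex
import Literature.NumberTheory.Transcendental.SemialgebraicLineDeriv
import Literature.ModelTheory.ExponentialFields.CylindricalDecompositionProofs
import Literature.NumberTheory.Transcendental.KZTameMoveFamily
import Literature.NumberTheory.Transcendental.KZTorusLogRep
import Mathlib.Analysis.SpecialFunctions.Trigonometric.ArctanDeriv
import Mathlib.Tactic.LinearCombination
import Mathlib.Tactic.Module

/-! # `RootDecompRelativeModAbsoluteAngleFoldP1` — part 1/9 of the mechanical ≤400-line split of `af_src.lean` (sha256 2a2742458ba4dd14…)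
Source: decomp-kz lens-3 g14 AngleFold.lean @5fd37862 (lint-fixed copy @30e24be4 by writer g8 per critic g6-12): ANGLE ADDITION IN FAMILIES — angleCellwiseFoldAt_one : AngleCellwiseFoldAt 1 PROVED (critic CLEARED g6-12 l.1335); --supports stmt-KontsevichZagierPeriods-30572.
Split by census-1 g10 `gen/splitlean.py`: scopes re-opened with their `open`/`variable`/`set_option` context; mathematics and declaration order unchanged. -/

/-!
# Route RootDecompRelativeModAbsolute · rung 30571/30572 · circle leaf — the ANGLE FOLD (decomp-kz lens-3 g14, `AngleFold.lean`)

KZ-side companion of `CircleDescent.lean`.  MAIN THEOREM (§G): `angleCellwiseFoldAt_one : AngleCellwiseFoldAt 1` — the residual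
`AngleCellwiseFoldAt 1` (tree `…Theorems.RootDecompRelativeModAbsoluteCircleLogP7`, = `CircleSplit.lean` §15) of the circle node
`CylKernelZeroCirclePos ⟸ LogCellwiseFoldAt 1 ∧ AngleCellwiseFoldAt 1 ∧ CellCloseCSWild` (`CircleSplit.lean` g14 §25
`cylKernelZeroCirclePos_of_logFold_angleFold_wild`) is PROVED inside the honest four-move Kontsevich–Zagier calculus
(ANGLE ADDITION IN FAMILIES), so the node becomes `CylKernelZeroCirclePos ⟸ LogCellwiseFoldAt 1 [tree theorem] ∧ CellCloseCSWild`.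
Bottom-up:

* §A the CONSTANT angle fold `constAngleFold_exact`: every exact integer relation `Σ_j g_j arctan d_j = 0` among arctangents of
  nonnegative real-algebraic constants is generated by KZ moves, uniformly in an integrable `ℚ`-semialgebraic coefficient:
  `Σ_j g_j • ⟦band T 0 d_j, κ/(1+t²)⟧ = 0` in `FormalRep ⧸ relations` (accumulator of normal forms `k·π/2 ± arctan a`; the two engine
  moves `angle_addition_mem_relations` (sheet `ad < 1`, tree P49) and `reciprocal_mem_relations` (tree P50); the sheets `ad > 1`, `ad = 1`
  and subtraction are formal consequences);
* §C the constant-DATA fold with budget `constAngleFold` (`Σ_s q'_s m_s = 0`): linear algebra over `ℚ` (a maximal independent subfamily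
  of the homogenised relation vectors and a rational left inverse) makes the coefficients INTEGRABLE combinations of the `p_j`, then §A;
* §B1 KZ rule 2 packaged: `of_sub_of_mem_relations_of_subst` (substitution along the graph map `(ξ,t) ↦ (ξ, ψ ξ t)`, Jacobian
  `|∂ₜψ|` via `LinearMap.det_of_snoc_init`); §E0 `loc` (localisation of a sum of band reps to an a.e. partition of the base);
* §B2–§B5 the HALF-CELL fold `half_top`: on an open order-convex `ℚ`-sa `T ⊆ ℝ¹` where every `u_j` is `C¹`, monotone (or constant) and
  on one side of `1`, the band over `{ξ ≥ x₀}` minus the constant band at the base point `x₀` is, by rule 2 with `t = u_j(ξ)`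
  (`dec_piece`; `inc_piece` through reciprocity `t ↦ 1/t`), a band with the JACOBIAN integrand `p_j u_j'/(1+u_j²)`; these cancel identically
  across `j` (`sum_wfun_eq_zero`: the derivative of `Σ_j f'_sj arctan u_j = m_s π` is `0` and `p_j = Σ_s q'_s f'_sj`), leaving constant data (§C);
* §B6 `half_bot` by the reflection `ξ ↦ −ξ` (rule 2 with the linear map `flipLin`, `|det| = 1`);
* §F the CELL fold: smooth locus (`exists_open_smooth_subset`, tree P23), interval cells of the level-1 CAD adapted to the sign conditions
  `u_j' ≷ 0`, `u_j ≷ 1` (`interval_cells`), one RATIONAL cut point per cell (`Rat.denseRange_cast`) so that the constant reps at the cut are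
  integrable on the compact closure (`interval_fold`, `cell_fold`), and `loc` twice; §G the bridge to the tree's `AngleCellwiseFoldAt 1`
  with a `#guard_msgs`-certified axiom list `[propext, Classical.choice, Quot.sound]`.
-/

noncomputable section

open Set MeasureTheory
open Literature.NumberTheory.Transcendental Literature.ModelTheory.ExponentialFields

namespace Summit.KontsevichZagierPeriods.RootDecompRelativeModAbsolute.Rung30571.RegularisedLogLayer.CylLog.Leaf.G13

namespace AngleFold

/-! ### §A0 The quotient by the KZ relations (bookkeeping in an additive group). -/

/-- Formal combinations of integral representations modulo the KZ relations. -/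
abbrev Q : Type := KZ.FormalRep ⧸ KZ.relations

/-- The projection to the quotient. -/
def mk : KZ.FormalRep →+ Q := QuotientAddGroup.mk' KZ.relations

/-- Auxiliary step `mk_eq_zero_iff` (§A0): mk eq zero iff. [bookkeeping] -/
theorem mk_eq_zero_iff {c : KZ.FormalRep} : mk c = 0 ↔ c ∈ KZ.relations :=
  QuotientAddGroup.eq_zero_iff c

/-- Auxiliary step `mk_eq_zero` (§A0): mk eq zero. [bookkeeping] -/
theorem mk_eq_zero {c : KZ.FormalRep} (h : c ∈ KZ.relations) : mk c = 0 := mk_eq_zero_iff.2 h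

/-- The class of a representation. -/
def cl {n : ℕ} (r : KZ.IntegralRep n) : Q := mk (KZ.of r)

/-- Auxiliary step `cl_eq_zero_of_volume` (§A0): cl eq zero of volume. [bookkeeping] -/
theorem cl_eq_zero_of_volume {n : ℕ} (r : KZ.IntegralRep n) (h : volume r.domain = 0) : cl r = 0 :=
  mk_eq_zero (KZ.of_mem_relations_of_volume_eq_zero r h)

/-- Auxiliary step `cl_eq_zero_of_eqOn_zero` (§A0): cl eq zero of eq On zero. [bookkeeping] -/
theorem cl_eq_zero_of_eqOn_zero {n : ℕ} (r : KZ.IntegralRep n) (h : EqOn r.integrand 0 r.domain) : cl r = 0 :=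
  mk_eq_zero (KZ.of_mem_relations_of_eqOn_zero r h)

/-- Auxiliary step `cl_eq_of_eqOn` (§A0): cl eq of eq On. [bookkeeping] -/
theorem cl_eq_of_eqOn {n : ℕ} {r r' : KZ.IntegralRep n} (hd : r'.domain = r.domain)
    (h : EqOn r.integrand r'.integrand r.domain) : cl r = cl r' := by
  have := mk_eq_zero (KZ.of_sub_of_mem_relations_of_eqOn hd h)
  rw [map_sub, sub_eq_zero] at this
  exact this

/-! ### §A1 Honest unfolded arctangent monomials `[band G 0 u, q/(1+t²)]`. -/

/-- Fibre bound for the arctangent kernel on `[0, c]`, `c ≥ 0`: `∫⁻_{[0,c]} ‖q/(1+t²)‖ ≤ ‖q·arctan c‖`. -/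
theorem lintegral_arctanKernel_le (q : ℝ) {c : ℝ} (hc : 0 ≤ c) :
    ∫⁻ t in Icc 0 c, ‖q / (1 + t ^ 2)‖ₑ ≤ ‖q * Real.arctan c‖ₑ := by
  have hcont : ContinuousOn (fun t : ℝ => q / (1 + t ^ 2)) (Icc 0 c) :=
    continuousOn_const.div (by fun_prop) fun t _ => by positivity
  have hg_int : IntegrableOn (fun t : ℝ => q / (1 + t ^ 2)) (Icc 0 c) := hcont.integrableOn_compact isCompact_Icc
  have hL : ∫⁻ t in Icc 0 c, ‖q / (1 + t ^ 2)‖ₑ = ENNReal.ofReal (∫ t in Icc 0 c, ‖q / (1 + t ^ 2)‖) :=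
    (ofReal_integral_norm_eq_lintegral_enorm hg_int).symm
  have hK0 : 0 ≤ |q| * Real.arctan c := mul_nonneg (abs_nonneg _) (Real.arctan_nonneg.2 hc)
  rw [hL, show ‖q * Real.arctan c‖ₑ = ENNReal.ofReal (|q| * Real.arctan c) by
    rw [← Real.enorm_eq_ofReal hK0]
    simp [enorm_mul, Real.enorm_eq_ofReal_abs, abs_of_nonneg (Real.arctan_nonneg.2 hc)]]
  refine ENNReal.ofReal_le_ofReal (le_of_eq ?_)
  have heq : EqOn (fun t : ℝ => ‖q / (1 + t ^ 2)‖) (fun t => |q| * (1 + t ^ 2)⁻¹) (Icc 0 c) := fun t _ => by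
    show ‖q / (1 + t ^ 2)‖ = |q| * (1 + t ^ 2)⁻¹
    rw [Real.norm_eq_abs, abs_div, abs_of_pos (by positivity : (0:ℝ) < 1 + t ^ 2), div_eq_mul_inv]
  rw [setIntegral_congr_fun measurableSet_Icc heq, integral_Icc_eq_integral_Ioc,
    ← intervalIntegral.integral_of_le hc, intervalIntegral.integral_const_mul, integral_inv_one_add_sq,
    Real.arctan_zero, sub_zero]

/-- **Honesty of an unfolded arctangent monomial from the base bound**: for `ℚ`-semialgebraic `q`, `u ≥ 0` on `G` with
`q·arctan u ∈ L¹(G)`, the integrand `q(x)/(1+t²)` is integrable on the band `{x ∈ G, 0 ≤ t ≤ u x}`. -/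
theorem integrableOn_arctanKernel_band {m : ℕ} {G : Set (Fin m → ℝ)} {u q : (Fin m → ℝ) → ℝ}
    (hG : IsSemialgebraic ℚ G) (hu : IsSemialgebraicFunOn ℚ G u) (hq : IsSemialgebraicFunOn ℚ G q)
    (hu0 : ∀ y ∈ G, 0 ≤ u y) (hint : IntegrableOn (fun y => q y * Real.arctan (u y)) G) :
    IntegrableOn (fun z : Fin (m + 1) → ℝ => q (Fin.init z) / (1 + z (Fin.last m) ^ 2))
      (KZlog.band G (fun _ => 0) u) := by
  have h0sa : IsSemialgebraicFunOn ℚ G (fun _ => (0:ℝ)) := (isSemialgebraicFunOn_ratCast hG 0).congr fun _ _ => by simp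
  have hbsa : IsSemialgebraic ℚ (KZlog.band G (fun _ => (0:ℝ)) u) := KZlog.isSemialgebraic_band h0sa hu
  have hGm : MeasurableSet G := hG.measurableSet_holds
  have hBm : MeasurableSet (KZlog.band G (fun _ => (0:ℝ)) u) := hbsa.measurableSet_holds
  have hRsa : IsSemialgebraicFunOn ℚ (KZlog.band G (fun _ => (0:ℝ)) u)
      (fun z => q (Fin.init z) / (1 + z (Fin.last m) ^ 2)) :=
    IsSemialgebraicFunOn.div (hq.comp_init.mono (fun z hz => hz.1) hbsa)
      ((IsSemialgebraicFunOn.add_holds ((isSemialgebraicFunOn_ratCast hbsa 1).congr fun _ _ => by simp)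
        ((Literature.NumberTheory.Transcendental.isSemialgebraicFunOn_apply hbsa (Fin.last m)).fun_pow 2)).congr fun _ _ => rfl)
      fun z _ => by positivity
  refine KZlog.integrableOn_band_of_lintegral_fibre_le hGm (a := fun _ => (0:ℝ)) (b := u) hBm
    (fun x t => KZlog.snoc_mem_band) (KZ.aestronglyMeasurable_of_isSemialgebraicFunOn hRsa hBm)
    (K := fun x => q x * Real.arctan (u x)) (fun x hx => ?_) hint
  simp only [Fin.init_snoc, Fin.snoc_last]
  exact lintegral_arctanKernel_le (q x) (hu0 x hx)

/-- The honest unfolded arctangent monomial `[band G 0 u, q/(1+t²)]`. -/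
def arctanRep {m : ℕ} {G : Set (Fin m → ℝ)} {u q : (Fin m → ℝ) → ℝ}
    (hG : IsSemialgebraic ℚ G) (hu : IsSemialgebraicFunOn ℚ G u) (hq : IsSemialgebraicFunOn ℚ G q)
    (hu0 : ∀ y ∈ G, 0 ≤ u y) (hint : IntegrableOn (fun y => q y * Real.arctan (u y)) G) : KZ.IntegralRep (m + 1) where
  domain := KZlog.band G (fun _ => 0) u
  integrand := fun z => q (Fin.init z) / (1 + z (Fin.last m) ^ 2)
  isSemialgebraic_domain := KZlog.isSemialgebraic_band
    ((isSemialgebraicFunOn_ratCast hG 0).congr fun _ _ => by simp) hu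
  isSemialgebraicFunOn_integrand := by
    have hbsa : IsSemialgebraic ℚ (KZlog.band G (fun _ => (0:ℝ)) u) :=
      KZlog.isSemialgebraic_band ((isSemialgebraicFunOn_ratCast hG 0).congr fun _ _ => by simp) hu
    exact IsSemialgebraicFunOn.div (hq.comp_init.mono (fun z hz => hz.1) hbsa)
      ((IsSemialgebraicFunOn.add_holds ((isSemialgebraicFunOn_ratCast hbsa 1).congr fun _ _ => by simp)
        ((Literature.NumberTheory.Transcendental.isSemialgebraicFunOn_apply hbsa (Fin.last m)).fun_pow 2)).congr fun _ _ => rfl)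
      fun z _ => by positivity
  integrableOn := integrableOn_arctanKernel_band hG hu hq hu0 hint

/-- Auxiliary step `arctanRep_domain` (§A1): arctan Rep domain. [bookkeeping] -/
@[simp] theorem arctanRep_domain {m : ℕ} {G : Set (Fin m → ℝ)} {u q : (Fin m → ℝ) → ℝ}
    (hG : IsSemialgebraic ℚ G) (hu : IsSemialgebraicFunOn ℚ G u) (hq : IsSemialgebraicFunOn ℚ G q)
    (hu0 : ∀ y ∈ G, 0 ≤ u y) (hint : IntegrableOn (fun y => q y * Real.arctan (u y)) G) :
    (arctanRep hG hu hq hu0 hint).domain = KZlog.band G (fun _ => 0) u := rfl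

/-- Auxiliary step `arctanRep_integrand` (§A1): arctan Rep integrand. [bookkeeping] -/
@[simp] theorem arctanRep_integrand {m : ℕ} {G : Set (Fin m → ℝ)} {u q : (Fin m → ℝ) → ℝ}
    (hG : IsSemialgebraic ℚ G) (hu : IsSemialgebraicFunOn ℚ G u) (hq : IsSemialgebraicFunOn ℚ G q)
    (hu0 : ∀ y ∈ G, 0 ≤ u y) (hint : IntegrableOn (fun y => q y * Real.arctan (u y)) G) :
    (arctanRep hG hu hq hu0 hint).integrand = fun z => q (Fin.init z) / (1 + z (Fin.last m) ^ 2) := rfl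

/-! ### §A2 A fixed base: `ℚ`-semialgebraic `T` with an integrable `ℚ`-semialgebraic coefficient `κ`; the classes
`A c = [band T 0 c, κ/(1+t²)]` of the constant-argument arctangent monomials. -/

/-- `c` is a `ℚ`-semialgebraic constant over `T` (for `T ≠ ∅`: `c` is real algebraic). -/
abbrev SaConst {m : ℕ} (T : Set (Fin m → ℝ)) (c : ℝ) : Prop := IsSemialgebraicFunOn ℚ T (fun _ => c)

section SaConst
variable {m : ℕ} {T : Set (Fin m → ℝ)}

/-- Auxiliary step `saConst_ratCast` (§A2): sa Const rat Cast. [bookkeeping] -/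
theorem saConst_ratCast (hT : IsSemialgebraic ℚ T) (q : ℚ) : SaConst T (q : ℝ) := isSemialgebraicFunOn_ratCast hT q
/-- Auxiliary step `saConst_zero` (§A2): sa Const zero. [bookkeeping] -/
theorem saConst_zero (hT : IsSemialgebraic ℚ T) : SaConst T 0 := (saConst_ratCast hT 0).congr fun _ _ => by simp
/-- Auxiliary step `saConst_one` (§A2): sa Const one. [bookkeeping] -/
theorem saConst_one (hT : IsSemialgebraic ℚ T) : SaConst T 1 := (saConst_ratCast hT 1).congr fun _ _ => by simp
/-- Auxiliary step `add` (§A2): add. [bookkeeping] -/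
theorem SaConst.add {c d : ℝ} (hc : SaConst T c) (hd : SaConst T d) : SaConst T (c + d) :=
  (IsSemialgebraicFunOn.add_holds hc hd).congr fun _ _ => rfl
/-- Auxiliary step `sub` (§A2): sub. [bookkeeping] -/
theorem SaConst.sub {c d : ℝ} (hc : SaConst T c) (hd : SaConst T d) : SaConst T (c - d) :=
  (IsSemialgebraicFunOn.sub_holds hc hd).congr fun _ _ => rfl
/-- Auxiliary step `mul` (§A2): mul. [bookkeeping] -/
theorem SaConst.mul {c d : ℝ} (hc : SaConst T c) (hd : SaConst T d) : SaConst T (c * d) :=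
  (IsSemialgebraicFunOn.mul_holds hc hd).congr fun _ _ => rfl
/-- Auxiliary step `div` (§A2): div. [bookkeeping] -/
theorem SaConst.div {c d : ℝ} (hc : SaConst T c) (hd : SaConst T d) (h : d ≠ 0) : SaConst T (c / d) :=
  (IsSemialgebraicFunOn.div hc hd fun _ _ => h).congr fun _ _ => rfl

end SaConst

/-- A fixed base for the constant angle fold. -/
structure Base (m : ℕ) where
  T : Set (Fin m → ℝ)
  κ : (Fin m → ℝ) → ℝ
  hT : IsSemialgebraic ℚ T
  hκ : IsSemialgebraicFunOn ℚ T κ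
  hκi : IntegrableOn κ T

namespace Base

variable {m : ℕ} (B : Base m)

/-- The honest monomial `[band T 0 c, κ/(1+t²)]` for an admissible constant `c`. -/
def rep {c : ℝ} (h0 : 0 ≤ c) (hs : SaConst B.T c) : KZ.IntegralRep (m + 1) :=
  arctanRep B.hT hs B.hκ (fun _ _ => h0) (B.hκi.mul_const _)

open Classical in
/-- The class `A c` of `[band T 0 c, κ/(1+t²)]` (junk value `0` for inadmissible `c`). -/
def A (c : ℝ) : Q :=
  if h : 0 ≤ c ∧ SaConst B.T c then cl (B.rep h.1 h.2) else 0

/-- Auxiliary step `A_eq` (§A2): A eq. [bookkeeping] -/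
theorem A_eq {c : ℝ} (h0 : 0 ≤ c) (hs : SaConst B.T c) : B.A c = cl (B.rep h0 hs) := by
  unfold A; rw [dif_pos ⟨h0, hs⟩]

/-- Auxiliary step `rep_domain` (§A2): rep domain. [bookkeeping] -/
theorem rep_domain {c : ℝ} (h0 : 0 ≤ c) (hs : SaConst B.T c) :
    (B.rep h0 hs).domain = KZlog.band B.T (fun _ => 0) (fun _ => c) := rfl

/-- Auxiliary step `rep_integrand` (§A2): rep integrand. [bookkeeping] -/
theorem rep_integrand {c : ℝ} (h0 : 0 ≤ c) (hs : SaConst B.T c) :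
    (B.rep h0 hs).integrand = fun z => B.κ (Fin.init z) / (1 + z (Fin.last m) ^ 2) := rfl

/-- `A 0 = 0` (null domain). -/
theorem A_zero : B.A 0 = 0 := by
  rw [B.A_eq le_rfl (saConst_zero B.hT)]
  refine cl_eq_zero_of_volume _ (measure_mono_null (fun z hz => ?_) (KZ.volume_setOf_last_eq_zero (0:ℝ)))
  have h := (KZlog.mem_band.1 (show z ∈ KZlog.band B.T (fun _ => (0:ℝ)) (fun _ => (0:ℝ)) from hz)).2
  exact le_antisymm h.2 h.1

/-! ### §A3 The two engine moves on constants and their formal consequences. -/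

/-- K3 (sheet `ad < 1`, the tree's `angle_addition_mem_relations`): `A a + A d = A ((a+d)/(1−ad))`. -/
theorem A_add_of_lt {a d : ℝ} (ha : 0 ≤ a) (hd : 0 ≤ d) (has : SaConst B.T a) (hds : SaConst B.T d)
    (hlt : a * d < 1) : B.A a + B.A d = B.A ((a + d) / (1 - a * d)) := by
  have hden : 0 < 1 - a * d := by linarith
  have he0 : 0 ≤ (a + d) / (1 - a * d) := div_nonneg (add_nonneg ha hd) hden.le
  have hes : SaConst B.T ((a + d) / (1 - a * d)) :=
    (has.add hds).div ((saConst_one B.hT).sub (has.mul hds)) hden.ne'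
  rw [B.A_eq ha has, B.A_eq hd hds, B.A_eq he0 hes]
  have h := angle_addition_mem_relations (u₁ := fun _ => a) (u₂ := fun _ => d) (p := B.κ)
    (B.rep ha has) (B.rep hd hds) (B.rep he0 hes) B.hT has hds (fun _ _ => ha) (fun _ _ => hd)
    (fun _ _ => hlt) (fun _ _ => differentiableAt_const _) rfl rfl rfl rfl rfl rfl
  have h' := mk_eq_zero h
  rw [map_sub, map_add] at h'
  exact (sub_eq_zero.1 h')

/-- K4 (the tree's `reciprocal_mem_relations`): `A a + A (1/a) = 2 • A 1` for `a > 0`. -/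
theorem A_add_inv {a : ℝ} (ha : 0 < a) (has : SaConst B.T a) : B.A a + B.A (1 / a) = (2:ℤ) • B.A 1 := by
  have h1s := saConst_one B.hT
  have his : SaConst B.T (1 / a) := h1s.div has ha.ne'
  -- reduce to `a ≥ 1` by symmetry
  suffices key : ∀ b : ℝ, 1 ≤ b → SaConst B.T b → B.A b + B.A (1 / b) = (2:ℤ) • B.A 1 by
    rcases le_or_gt 1 a with h | h
    · exact key a h has
    · have := key (1 / a) (by rw [le_div_iff₀ ha]; linarith) his
      rwa [one_div_one_div, add_comm] at this
  intro b hb hbs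
  have hb0 : 0 < b := one_pos.trans_le hb
  have hbi0 : (0:ℝ) ≤ 1 / b := by positivity
  have hbis : SaConst B.T (1 / b) := h1s.div hbs hb0.ne'
  rw [B.A_eq hb0.le hbs, B.A_eq hbi0 hbis, B.A_eq zero_le_one h1s]
  have h := reciprocal_mem_relations (u := fun _ => b) (p := B.κ)
    (B.rep hb0.le hbs) (B.rep hbi0 hbis) (B.rep zero_le_one h1s) B.hT hbs
    (fun _ _ => hb) (fun _ _ => differentiableAt_const _) rfl rfl rfl rfl rfl rfl
  have h' := mk_eq_zero h
  rw [map_sub, map_sub, map_add] at h'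
  have : cl (B.rep hb0.le hbs) + cl (B.rep hbi0 hbis) - cl (B.rep zero_le_one h1s)
      - cl (B.rep zero_le_one h1s) = 0 := h'
  linear_combination (norm := module) this

/-- K6 (`ad = 1`): `A a + A d = 2 • A 1`. -/
theorem A_add_of_eq {a d : ℝ} (ha : 0 ≤ a) (has : SaConst B.T a) (h1 : a * d = 1) :
    B.A a + B.A d = (2:ℤ) • B.A 1 := by
  have ha0 : a ≠ 0 := fun h => by rw [h, zero_mul] at h1; exact zero_ne_one h1
  have hapos : 0 < a := lt_of_le_of_ne ha (Ne.symm ha0)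
  have hd : d = 1 / a := by field_simp; linarith
  rw [hd]
  exact B.A_add_inv hapos has

/-- K5 (sheet `ad > 1`): `A a + A d = 4 • A 1 − A ((a+d)/(ad−1))`. -/
theorem A_add_of_gt {a d : ℝ} (ha : 0 ≤ a) (hd : 0 ≤ d) (has : SaConst B.T a) (hds : SaConst B.T d)
    (hgt : 1 < a * d) : B.A a + B.A d = (4:ℤ) • B.A 1 - B.A ((a + d) / (a * d - 1)) := by
  have ha0 : 0 < a := by
    rcases eq_or_lt_of_le ha with h | h
    · rw [← h, zero_mul] at hgt; linarith
    · exact h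
  have hd0 : 0 < d := by
    rcases eq_or_lt_of_le hd with h | h
    · rw [← h, mul_zero] at hgt; linarith
    · exact h
  have hia : SaConst B.T (1 / a) := (saConst_one B.hT).div has ha0.ne'
  have hid : SaConst B.T (1 / d) := (saConst_one B.hT).div hds hd0.ne'
  have hlt : 1 / a * (1 / d) < 1 := by
    rw [one_div_mul_one_div, div_lt_one (mul_pos ha0 hd0)]; linarith
  have h3 := B.A_add_of_lt (by positivity) (by positivity) hia hid hlt
  have he : (1 / a + 1 / d) / (1 - 1 / a * (1 / d)) = (a + d) / (a * d - 1) := by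
    have : a * d - 1 ≠ 0 := by linarith
    field_simp
    ring
  rw [he] at h3
  have h1 := B.A_add_inv ha0 has
  have h2 := B.A_add_inv hd0 hds
  linear_combination (norm := module) h1 + h2 - h3

/-- K7 (subtraction): `A a − A d = A ((a−d)/(1+ad))` for `0 ≤ d ≤ a`. -/
theorem A_sub_of_le {a d : ℝ} (hd : 0 ≤ d) (hda : d ≤ a) (has : SaConst B.T a) (hds : SaConst B.T d) :
    B.A a - B.A d = B.A ((a - d) / (1 + a * d)) := by
  have ha : 0 ≤ a := hd.trans hda
  have hden : 0 < 1 + a * d := by positivity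
  have he0 : 0 ≤ (a - d) / (1 + a * d) := div_nonneg (by linarith) hden.le
  have hes : SaConst B.T ((a - d) / (1 + a * d)) :=
    (has.sub hds).div ((saConst_one B.hT).add (has.mul hds)) hden.ne'
  have hlt : d * ((a - d) / (1 + a * d)) < 1 := by
    rw [mul_div_assoc', div_lt_one hden]; nlinarith [sq_nonneg d]
  have h3 := B.A_add_of_lt hd he0 hds hes hlt
  have hne : 1 - d * ((a - d) / (1 + a * d)) ≠ 0 := by linarith
  have hid : (d + (a - d) / (1 + a * d)) / (1 - d * ((a - d) / (1 + a * d))) = a := by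
    have h1 : 1 + a * d ≠ 0 := hden.ne'
    rw [div_eq_iff hne]
    field_simp
    ring
  rw [hid] at h3
  linear_combination (norm := abel) -h3

end Base

/-! ### §A4 The accumulator: normal forms `k·(π/2) ± arctan a` and the exact constant angle fold. -/

namespace Base

variable {m : ℕ} (B : Base m)

/-- Real side of the four cases. -/
theorem arctan_add_of_prod_gt {a d : ℝ} (ha : 0 ≤ a) (hgt : 1 < a * d) :
    Real.arctan a + Real.arctan d = Real.pi - Real.arctan ((a + d) / (a * d - 1)) := by
  have ha0 : 0 < a := by
    rcases eq_or_lt_of_le ha with h | h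
    · rw [← h, zero_mul] at hgt; linarith
    · exact h
  rw [Real.arctan_add_eq_add_pi hgt ha0]
  have : (a + d) / (1 - a * d) = -((a + d) / (a * d - 1)) := by
    rw [← div_neg, neg_sub]
  rw [this, Real.arctan_neg]; ring

/-- Auxiliary step `arctan_add_of_prod_eq` (§A4): arctan add of prod eq. [bookkeeping] -/
theorem arctan_add_of_prod_eq {a d : ℝ} (ha : 0 ≤ a) (h1 : a * d = 1) :
    Real.arctan a + Real.arctan d = Real.pi / 2 := by
  have ha0 : a ≠ 0 := fun h => by rw [h, zero_mul] at h1; exact zero_ne_one h1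
  have hapos : 0 < a := lt_of_le_of_ne ha (Ne.symm ha0)
  have hd : d = a⁻¹ := by field_simp; linarith
  rw [hd, Real.arctan_inv_of_pos hapos]; ring

/-- Auxiliary step `arctan_sub_of_le` (§A4): arctan sub of le. [bookkeeping] -/
theorem arctan_sub_of_le {a d : ℝ} (hd : 0 ≤ d) (hda : d ≤ a) :
    Real.arctan a - Real.arctan d = Real.arctan ((a - d) / (1 + a * d)) := by
  have ha : 0 ≤ a := hd.trans hda
  have hden : 0 < 1 + a * d := by positivity
  have hlt : d * ((a - d) / (1 + a * d)) < 1 := by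
    rw [mul_div_assoc', div_lt_one hden]; nlinarith [sq_nonneg d]
  have hne : 1 - d * ((a - d) / (1 + a * d)) ≠ 0 := by linarith
  have hid : (d + (a - d) / (1 + a * d)) / (1 - d * ((a - d) / (1 + a * d))) = a := by
    have h1 : 1 + a * d ≠ 0 := hden.ne'
    rw [div_eq_iff hne]
    field_simp
    ring
  have h := Real.arctan_add hlt
  rw [hid] at h
  linarith

end Base
end AngleFold
end Summit.KontsevichZagierPeriods.RootDecompRelativeModAbsolute.Rung30571.RegularisedLogLayer.CylLog.Leaf.G13
end
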